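/-
Copyright: the b2b-balaban cell (near-miss cell 7), T⁴-continuum fan-out, lineage t4-ne7b-p1 (node U5c COUNT member).
Released under the licence of the surrounding project.
-/
import Literature.MathematicalPhysics.QuantumFieldTheory.Balaban1983to89.T4PartnerMultiplicity

/-!
# Placement skeleton (part 1 of 2): the multiplicity of POSITIONED genealogies, assembled along `Gen.merge`

Summits-side support leaf of the T⁴-continuum cell (rung (B)+1 on a FINITE torus only; NOT infinite volume, NOT the
mass gap, NOT the Clay statement; NOT a proof of the spine estimate NE7b).  Lineage `t4-ne7b-p1`, node U5c, wall (GM)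
of the cell's gap census (the merger-multiplicity inequality consumed as the binder `hlabM` of
`T4PartnerMultiplicity.exists_irThreshold_relWeightBoundM`, exponent `partnerAges`).  Everything here is [folklore]
finite combinatorics; nothing is quoted from print and nothing printed is asserted.

WHAT THIS FILE DOES.  A one-merger geometry bound says: the birth cells of a piece `q` whose image touches a given piece
`q'` at the merger step `t` number at most `N q q' t`.  This file ASSEMBLES such bounds along an abstract genealogy
`G : Gen ε` (`T4PersistenceDictionary.Gen`).  Births are placed in an abstract finite cell type `γ`; a placement is a
map `P : ε → γ`; admissibility `Adm touch st G P` is defined by structural recursion (at `Gen.merge X Y e`: both halves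
admissible and SOME piece `q` born in `Y` touches SOME piece `q'` born in `X` at step `st e`, through an abstract
relation `touch q q' t x y` on birth cells).  §1: `births`, `Separated` (the two halves of a merger have disjoint
births; automatic for `Gen.WF`, `separated_of_wf`), `StepsOK`, `Ordered`, the recursive sums `mergeSum`, `birthSum`.
§2: THE PARTNER-AGES IDENTITY `partnerAges st G + birthSum st G = mergeSum st G + rootStep G`
(`partnerAges_add_birthSum`: each non-root birth is the younger root at exactly one merger).  §3: the RE-ROOTED PRODUCT
`weight N st G p` (`weight (merge X Y e) p = weight X p · Σ_{q ∈ births Y} Σ_{q' ∈ births X} N q q' (st e) · weight Y q`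
for `p` born in `X`, symmetrically for `p` born in `Y`), the generic link count `card_link_le` (restriction to the two
halves is injective; locality `adm_congr`), and the theorem `card_admSet_le_weight`: for a separated genealogy, every
piece `p` born in it and every cell `c`, the admissible placements with `P p = c` (junk value `c₀` off the births)
number AT MOST `weight N st G p`, given only the two one-merger bounds `hN1`/`hN2` (positions of the placed piece
touching a given position of the other piece are `≤ N placed other t`).  Part 2 (`Support/PlacementExponent.lean`)
does the exponent bookkeeping: with the fibre factor `N·Λ^{s} = M·Λ^{t+1}`, `weight G root = Λ^{partnerAges G}·comb`.

WHAT THIS FILE DOES NOT DO / LOCATED.  (i) It does not instantiate `N` or `touch`: that is the one-merger geometry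
leaf (`Support/PartnerPlacement.lean`) and the reading (ID) (which pieces, which shapes, which cells).  (ii) The
re-rooted product carries, per merger, a SUM OVER PAIRS (which piece of the younger structure touches which piece of the
older one): along a chain of `n` binary mergers at one step (the cell's own paraphrase, not a quotation) these sums
multiply to a factorial-type growth in the batch size, not to `c^{#events}` — whether the multiplicative form of (GM)
survives depends on how the reading caps simultaneous mergers (the dictionary's event alphabet `(step, kind, fat)`,
`fat < Dcap K`, caps them at `3·Dcap K` per step).  Recorded in the cell's gap census as a located item; nothing about it
is asserted here.  (iii) Finite types `ε`, `γ` (events and cells in play) are assumed for the counting theorems.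

HONEST DEPENDENCY (cell): continuum YM on T⁴ ⇐ BetaPertH ∧ nine spine estimates (0/9 proved); BetaPertH ⇐ (D1) ∧ (D4)
∧ CAP+tail.  This file changes none of it.
-/

open Finset
open Literature.MathematicalPhysics.QuantumFieldTheory.Balaban1983to89
open T4PersistenceDictionary T4PartnerMultiplicity

namespace Summit.QuantumFields.BalabanUV.T4Continuum.PlacementSkeleton

noncomputable section

variable {ε : Type*} [DecidableEq ε]

/-! ## §1 Births, separation, step data -/

/-- The BIRTH events of a genealogy (the leaves `born b j`). [folklore] -/
def births : Gen ε → Finset ε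
  | Gen.born b _ => {b}
  | Gen.renew G _ _ => births G
  | Gen.merge X Y _ => births X ∪ births Y

/-- births of a bare birth [folklore] -/
@[simp] theorem births_born (b : ε) (j : ℕ) : births (Gen.born b j) = {b} := rfl

/-- births are unchanged by a renewal [folklore] -/
@[simp] theorem births_renew (G : Gen ε) (e : ε) (h : ℕ) : births (Gen.renew G e h) = births G := rfl

/-- births of a merger [folklore] -/
@[simp] theorem births_merge (X Y : Gen ε) (e : ε) : births (Gen.merge X Y e) = births X ∪ births Y := rfl

/-- Births are events. [folklore] -/
theorem births_subset_events : ∀ G : Gen ε, births G ⊆ G.events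
  | Gen.born b j => by simp
  | Gen.renew G e h => fun x hx => by
      rw [births_renew] at hx
      rw [Gen.events_renew, mem_insert]
      exact Or.inr (births_subset_events G hx)
  | Gen.merge X Y e => fun x hx => by
      rw [births_merge, mem_union] at hx
      rw [Gen.events_merge, mem_insert, mem_union]
      rcases hx with hx | hx
      · exact Or.inr (Or.inl (births_subset_events X hx))
      · exact Or.inr (Or.inr (births_subset_events Y hx))

/-- The root is a birth. [folklore] -/
theorem root_mem_births : ∀ G : Gen ε, G.root ∈ births G
  | Gen.born b j => by simp [Gen.root]
  | Gen.renew G e h => by simpa [Gen.root] using root_mem_births G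
  | Gen.merge X Y e => by
      unfold Gen.root
      split_ifs
      · exact mem_union.2 (Or.inl (root_mem_births X))
      · exact mem_union.2 (Or.inr (root_mem_births Y))

/-- SEPARATED genealogies: the two partners of every merger have disjoint births. [folklore] -/
def Separated : Gen ε → Prop
  | Gen.born _ _ => True
  | Gen.renew G _ _ => Separated G
  | Gen.merge X Y _ => Separated X ∧ Separated Y ∧ Disjoint (births X) (births Y)

/-- Well-formed genealogies (`Gen.WF`: partners have disjoint events) are separated. [folklore] -/
theorem separated_of_wf (W : ε → ℕ) : ∀ {G : Gen ε}, G.WF W → Separated G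
  | Gen.born _ _, _ => trivial
  | Gen.renew G _ _, hW => separated_of_wf W (G := G) hW.1
  | Gen.merge X Y _, hW =>
      ⟨separated_of_wf W (G := X) hW.1, separated_of_wf W (G := Y) hW.2.1,
        Disjoint.mono (births_subset_events X) (births_subset_events Y) hW.2.2.2.2.1⟩

/-- STEP DATA: every birth event `b` of a leaf `born b j` has `st b = j`. [folklore] -/
def StepsOK (st : ε → ℕ) : Gen ε → Prop
  | Gen.born b j => st b = j
  | Gen.renew G _ _ => StepsOK st G
  | Gen.merge X Y _ => StepsOK st X ∧ StepsOK st Y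

/-- ORDERED genealogies: a merger event is at least one step before neither partner's root
(`rootStep ≤ st e + 1`; `T4PrintedShapeBanking.Consistent` gives the stronger `rootStep ≤ st e`). [folklore] -/
def Ordered (st : ε → ℕ) : Gen ε → Prop
  | Gen.born _ _ => True
  | Gen.renew G _ _ => Ordered st G
  | Gen.merge X Y e => Ordered st X ∧ Ordered st Y ∧ X.rootStep ≤ st e + 1 ∧ Y.rootStep ≤ st e + 1

/-- `Σ_{mergers} (st e + 1)`, by structural recursion. [folklore] -/
def mergeSum (st : ε → ℕ) : Gen ε → ℕ
  | Gen.born _ _ => 0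
  | Gen.renew G _ _ => mergeSum st G
  | Gen.merge X Y e => mergeSum st X + mergeSum st Y + (st e + 1)

/-- `Σ_{births} st b`, by structural recursion. [folklore] -/
def birthSum (st : ε → ℕ) : Gen ε → ℕ
  | Gen.born b _ => st b
  | Gen.renew G _ _ => birthSum st G
  | Gen.merge X Y _ => birthSum st X + birthSum st Y

/-- For a separated genealogy the recursive birth sum is the sum over the births. [folklore] -/
theorem birthSum_eq_sum (st : ε → ℕ) : ∀ {G : Gen ε}, Separated G → birthSum st G = ∑ b ∈ births G, st b
  | Gen.born b j, _ => by simp [birthSum]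
  | Gen.renew G e h, hS => birthSum_eq_sum st (G := G) hS
  | Gen.merge X Y e, hS => by
      rw [birthSum, births_merge, sum_union hS.2.2, birthSum_eq_sum st (G := X) hS.1,
        birthSum_eq_sum st (G := Y) hS.2.1]

omit [DecidableEq ε] in
/-- Under `StepsOK` the root step is the step of the root event. [folklore] -/
theorem rootStep_eq_st_root (st : ε → ℕ) : ∀ {G : Gen ε}, StepsOK st G → G.rootStep = st G.root
  | Gen.born b j, h => by simpa [Gen.root, StepsOK] using h.symm
  | Gen.renew G e h', hS => by
      rw [Gen.rootStep_renew]
      exact rootStep_eq_st_root st (G := G) hS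
  | Gen.merge X Y e, hS => by
      unfold Gen.root
      rw [Gen.rootStep_merge]
      split_ifs with h
      · rw [min_eq_left h]; exact rootStep_eq_st_root st (G := X) hS.1
      · rw [min_eq_right (le_of_lt (not_le.mp h))]; exact rootStep_eq_st_root st (G := Y) hS.2

/-! ## §2 The exponent identity: `partnerAges + Σ births = Σ (mergers + 1) + rootStep` -/

omit [DecidableEq ε] in
/-- **THE PARTNER-AGES IDENTITY.**  Each non-root birth is the younger root at exactly one merger, so
`partnerAges st G + Σ_{births} st b = Σ_{mergers} (st e + 1) + rootStep G`. [folklore] -/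
theorem partnerAges_add_birthSum (st : ε → ℕ) : ∀ {G : Gen ε}, StepsOK st G → Ordered st G →
    partnerAges st G + birthSum st G = mergeSum st G + G.rootStep
  | Gen.born b j, hS, _ => by simpa [birthSum, mergeSum, StepsOK] using hS
  | Gen.renew G e h, hS, hO => by
      rw [partnerAges_renew, birthSum, mergeSum, Gen.rootStep_renew]
      exact partnerAges_add_birthSum st (G := G) hS hO
  | Gen.merge X Y e, hS, hO => by
      obtain ⟨hSX, hSY⟩ := hS
      obtain ⟨hOX, hOY, hX, hY⟩ := hO
      have ihX := partnerAges_add_birthSum st (G := X) hSX hOX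
      have ihY := partnerAges_add_birthSum st (G := Y) hSY hOY
      rw [partnerAges_merge, birthSum, mergeSum, Gen.rootStep_merge]
      rcases le_total X.rootStep Y.rootStep with h | h
      · rw [max_eq_right h, min_eq_left h]; omega
      · rw [max_eq_left h, min_eq_right h]; omega

/-! ## §3 Admissible placements and the re-rooted product -/

variable {γ : Type*}

/-- ADMISSIBLE PLACEMENTS of a genealogy: at every merger some piece born in the younger argument touches some piece
born in the older one at the merger step (abstract relation `touch q q' t x y` between the birth cells `x` of `q` and `y`
of `q'`); renewals and births impose nothing (their multiplicities are booked elsewhere). [folklore] -/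
def Adm (touch : ε → ε → ℕ → γ → γ → Prop) (st : ε → ℕ) : Gen ε → (ε → γ) → Prop
  | Gen.born _ _, _ => True
  | Gen.renew G _ _, P => Adm touch st G P
  | Gen.merge X Y e, P => Adm touch st X P ∧ Adm touch st Y P ∧
      ∃ q ∈ births Y, ∃ q' ∈ births X, touch q q' (st e) (P q) (P q')

/-- LOCALITY: admissibility only reads the placement on the births. [folklore] -/
theorem adm_congr (touch : ε → ε → ℕ → γ → γ → Prop) (st : ε → ℕ) :
    ∀ (G : Gen ε) {P P' : ε → γ}, (∀ b ∈ births G, P b = P' b) → (Adm touch st G P ↔ Adm touch st G P')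
  | Gen.born _ _, _, _, _ => Iff.rfl
  | Gen.renew G _ _, _, _, h => adm_congr touch st G h
  | Gen.merge X Y e, P, P', h => by
      have hX : ∀ b ∈ births X, P b = P' b := fun b hb => h b (mem_union.2 (Or.inl hb))
      have hY : ∀ b ∈ births Y, P b = P' b := fun b hb => h b (mem_union.2 (Or.inr hb))
      simp only [Adm]
      rw [adm_congr touch st X hX, adm_congr touch st Y hY]
      constructor
      · rintro ⟨h1, h2, q, hq, q', hq', ht⟩
        exact ⟨h1, h2, q, hq, q', hq', by rwa [← hY q hq, ← hX q' hq']⟩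
      · rintro ⟨h1, h2, q, hq, q', hq', ht⟩
        exact ⟨h1, h2, q, hq, q', hq', by rwa [hY q hq, hX q' hq']⟩

/-- THE RE-ROOTED PRODUCT `weight N st G p` (piece `p` fixed): at a merger the side containing `p` keeps `p` fixed, the
other side is re-rooted at its touching piece, summed over the touching pair. [folklore] -/
def weight (N : ε → ε → ℕ → ℕ) (st : ε → ℕ) : Gen ε → ε → ℕ
  | Gen.born _ _, _ => 1
  | Gen.renew G _ _, p => weight N st G p
  | Gen.merge X Y e, p =>
      if p ∈ births X then weight N st X p * ∑ q ∈ births Y, ∑ q' ∈ births X, N q q' (st e) * weight N st Y q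
      else weight N st Y p * ∑ q' ∈ births X, ∑ q ∈ births Y, N q' q (st e) * weight N st X q'

section Count

variable [Fintype ε] [Fintype γ] [DecidableEq γ]

open scoped Classical

/-- The admissible placements of `G` with piece `p` at cell `c` and the junk value `c₀` off the births. [folklore] -/
def admSet (touch : ε → ε → ℕ → γ → γ → Prop) (st : ε → ℕ) (G : Gen ε) (p : ε) (c c₀ : γ) : Finset (ε → γ) :=
  univ.filter fun P => Adm touch st G P ∧ P p = c ∧ ∀ e, e ∉ births G → P e = c₀

/-- **THE GENERIC LINK COUNT.**  Two blocks of pieces `bU ⊇ {p, u}` and `bV ∋ v` with disjoint births, local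
admissibility predicates, and a link `R (P v) (P u)`: the joint placements with `p` at `c` number at most
`nU · (nR · nV)` — placements of the `U`-block with `p` at `c`, times positions of `v` linked to a given position of `u`,
times placements of the `V`-block with `v` at a given cell. [folklore] -/
theorem card_link_le (bU bV : Finset ε) (hUV : Disjoint bU bV) (AdmU AdmV : (ε → γ) → Prop)
    (hlocU : ∀ P P' : ε → γ, (∀ b ∈ bU, P b = P' b) → (AdmU P ↔ AdmU P'))
    (hlocV : ∀ P P' : ε → γ, (∀ b ∈ bV, P b = P' b) → (AdmV P ↔ AdmV P'))
    (R : γ → γ → Prop) {p u v : ε} (hp : p ∈ bU) (hu : u ∈ bU) (hv : v ∈ bV) (c c₀ : γ) {nU nR nV : ℕ}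
    (hnU : (univ.filter fun P : ε → γ => AdmU P ∧ P p = c ∧ ∀ e, e ∉ bU → P e = c₀).card ≤ nU)
    (hnR : ∀ y, (univ.filter fun x : γ => R x y).card ≤ nR)
    (hnV : ∀ x, (univ.filter fun P : ε → γ => AdmV P ∧ P v = x ∧ ∀ e, e ∉ bV → P e = c₀).card ≤ nV) :
    (univ.filter fun P : ε → γ => AdmU P ∧ AdmV P ∧ R (P v) (P u) ∧ P p = c ∧
        ∀ e, e ∉ bU ∪ bV → P e = c₀).card ≤ nU * (nR * nV) := by
  set A := univ.filter fun P : ε → γ => AdmU P ∧ AdmV P ∧ R (P v) (P u) ∧ P p = c ∧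
    ∀ e, e ∉ bU ∪ bV → P e = c₀ with hA
  set SU := univ.filter fun P : ε → γ => AdmU P ∧ P p = c ∧ ∀ e, e ∉ bU → P e = c₀ with hSU
  let resU : (ε → γ) → (ε → γ) := fun P e => if e ∈ bU then P e else c₀
  let resV : (ε → γ) → (ε → γ) := fun P e => if e ∈ bV then P e else c₀
  let FV : (ε → γ) → Finset (ε → γ) := fun PX =>
    univ.filter fun PY : ε → γ => AdmV PY ∧ R (PY v) (PX u) ∧ ∀ e, e ∉ bV → PY e = c₀
  have hvU : v ∉ bU := fun h => disjoint_left.1 hUV h hv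
  -- (1) restriction to the two blocks is injective on `A` and lands in the fibred set
  have h1 : A.card ≤ (SU.biUnion fun PX => (FV PX).image (Prod.mk PX)).card := by
    refine card_le_card_of_injOn (fun P => (resU P, resV P)) (fun P hP => ?_) ?_
    · replace hP : P ∈ A := Finset.mem_coe.1 hP
      rw [hA, mem_filter] at hP
      obtain ⟨-, hU, hV, hR, hpc, hoff⟩ := hP
      have hPU : ∀ b ∈ bU, resU P b = P b := fun b hb => by simp [resU, hb]
      have hPV : ∀ b ∈ bV, resV P b = P b := fun b hb => by simp [resV, hb]
      refine Finset.mem_coe.2 (mem_biUnion.2 ⟨resU P, ?_, mem_image.2 ⟨resV P, ?_, rfl⟩⟩)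
      · rw [hSU, mem_filter]
        refine ⟨mem_univ _, (hlocU _ _ hPU).2 hU, by rw [hPU p hp, hpc], fun e he => by simp [resU, he]⟩
      · rw [mem_filter]
        refine ⟨mem_univ _, (hlocV _ _ hPV).2 hV, by rw [hPV v hv, hPU u hu]; exact hR,
          fun e he => by simp [resV, he]⟩
    · intro P hP P' hP' hEq
      replace hP : P ∈ A := Finset.mem_coe.1 hP
      replace hP' : P' ∈ A := Finset.mem_coe.1 hP'
      rw [hA, mem_filter] at hP hP'
      obtain ⟨hEU, hEV⟩ := Prod.ext_iff.1 hEq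
      funext e
      by_cases heU : e ∈ bU
      · have := congrFun hEU e; simpa [resU, heU] using this
      · by_cases heV : e ∈ bV
        · have := congrFun hEV e; simpa [resV, heV] using this
        · have hn : e ∉ bU ∪ bV := by rw [mem_union]; tauto
          rw [hP.2.2.2.2.2 e hn, hP'.2.2.2.2.2 e hn]
  -- (2) each fibre: positions of `v` linked to `PX u`, then placements of the `V`-block with `v` there
  have h2 : ∀ PX : ε → γ, (FV PX).card ≤ nR * nV := by
    intro PX
    have hsub : FV PX ⊆ (univ.filter fun x : γ => R x (PX u)).biUnion fun x =>
        univ.filter fun PY : ε → γ => AdmV PY ∧ PY v = x ∧ ∀ e, e ∉ bV → PY e = c₀ := by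
      intro PY hPY
      rw [mem_filter] at hPY
      obtain ⟨-, hV, hR, hoff⟩ := hPY
      exact mem_biUnion.2 ⟨PY v, mem_filter.2 ⟨mem_univ _, hR⟩, mem_filter.2 ⟨mem_univ _, hV, rfl, hoff⟩⟩
    refine (card_le_card hsub).trans (card_biUnion_le.trans ?_)
    refine (sum_le_sum fun x _ => hnV x).trans ?_
    rw [sum_const, smul_eq_mul]
    exact Nat.mul_le_mul_right _ (hnR _)
  -- (3) assemble
  refine h1.trans (card_biUnion_le.trans ?_)
  refine (sum_le_sum fun PX _ => (card_image_le.trans (h2 PX))).trans ?_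
  rw [sum_const, smul_eq_mul]
  exact Nat.mul_le_mul_right _ hnU

/-- **PLACEMENT MULTIPLICITY ≤ THE RE-ROOTED PRODUCT.**  For a separated genealogy, a piece `p` born in it and a cell
`c`, the admissible placements with `p` at `c` number at most `weight N st G p`, given the two one-merger bounds:
positions of the placed piece touching a given position of the other piece are `≤ N placed other t`. [folklore] -/
theorem card_admSet_le_weight (touch : ε → ε → ℕ → γ → γ → Prop) (st : ε → ℕ) (N : ε → ε → ℕ → ℕ)
    (hN1 : ∀ q q' t y, (univ.filter fun x : γ => touch q q' t x y).card ≤ N q q' t)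
    (hN2 : ∀ q q' t x, (univ.filter fun y : γ => touch q q' t x y).card ≤ N q' q t) :
    ∀ (G : Gen ε), Separated G → ∀ p ∈ births G, ∀ c c₀ : γ,
      (admSet touch st G p c c₀).card ≤ weight N st G p
  | Gen.born b j, _, p, hp, c, c₀ => by
      have hpb : p = b := by simpa using hp
      subst hpb
      refine Finset.card_le_one.2 fun P hP P' hP' => ?_
      simp only [admSet, Adm, births_born, mem_singleton, true_and, mem_filter, mem_univ] at hP hP'
      funext e
      by_cases he : e = p
      · rw [he, hP.1, hP'.1]
      · rw [hP.2 e he, hP'.2 e he]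
  | Gen.renew G e h, hS, p, hp, c, c₀ =>
      card_admSet_le_weight touch st N hN1 hN2 G hS p hp c c₀
  | Gen.merge X Y e, hS, p, hp, c, c₀ => by
      obtain ⟨hSX, hSY, hd⟩ := hS
      have ihX := fun q hq x => card_admSet_le_weight touch st N hN1 hN2 X hSX q hq x c₀
      have ihY := fun q hq x => card_admSet_le_weight touch st N hN1 hN2 Y hSY q hq x c₀
      have hlocX := fun P P' h => adm_congr touch st X (P := P) (P' := P') h
      have hlocY := fun P P' h => adm_congr touch st Y (P := P) (P' := P') h
      -- cover by the touching pair
      have hcover : admSet touch st (Gen.merge X Y e) p c c₀ ⊆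
          (births Y).biUnion fun q => (births X).biUnion fun q' =>
            univ.filter fun P : ε → γ => Adm touch st X P ∧ Adm touch st Y P ∧
              touch q q' (st e) (P q) (P q') ∧ P p = c ∧ ∀ x, x ∉ births X ∪ births Y → P x = c₀ := by
        intro P hP
        simp only [admSet, Adm, births_merge, mem_filter, mem_univ, true_and] at hP
        obtain ⟨⟨hX, hY, q, hq, q', hq', ht⟩, hpc, hoff⟩ := hP
        simp only [mem_biUnion, mem_filter, mem_univ, true_and]
        exact ⟨q, hq, q', hq', hX, hY, ht, hpc, hoff⟩
      refine (card_le_card hcover).trans (card_biUnion_le.trans ?_)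
      by_cases hpX : p ∈ births X
      · rw [weight, if_pos hpX, mul_sum]
        refine sum_le_sum fun q hq => card_biUnion_le.trans ?_
        rw [mul_sum]
        refine sum_le_sum fun q' hq' => ?_
        exact card_link_le (births X) (births Y) hd _ _ hlocX hlocY (fun x y => touch q q' (st e) x y)
          hpX hq' hq c c₀ (ihX p hpX c) (hN1 q q' (st e)) (fun x => ihY q hq x)
      · have hpY : p ∈ births Y := by
          rcases mem_union.1 hp with h | h
          · exact absurd h hpX
          · exact h
        rw [weight, if_neg hpX, mul_sum]
        refine (sum_le_sum fun q _ => card_biUnion_le).trans ?_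
        rw [sum_comm]
        refine sum_le_sum fun q' hq' => ?_
        rw [mul_sum]
        refine sum_le_sum fun q hq => ?_
        have hset : (univ.filter fun P : ε → γ => Adm touch st X P ∧ Adm touch st Y P ∧
              touch q q' (st e) (P q) (P q') ∧ P p = c ∧ ∀ x, x ∉ births X ∪ births Y → P x = c₀) =
            univ.filter fun P : ε → γ => Adm touch st Y P ∧ Adm touch st X P ∧
              (fun x y => touch q q' (st e) y x) (P q') (P q) ∧ P p = c ∧
              ∀ x, x ∉ births Y ∪ births X → P x = c₀ := by
          refine filter_congr fun P _ => ?_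
          rw [union_comm]
          constructor
          · rintro ⟨h1, h2, h3, h4, h5⟩; exact ⟨h2, h1, h3, h4, h5⟩
          · rintro ⟨h1, h2, h3, h4, h5⟩; exact ⟨h2, h1, h3, h4, h5⟩
        rw [hset]
        exact card_link_le (births Y) (births X) hd.symm _ _ hlocY hlocX (fun x y => touch q q' (st e) y x)
          hpY hq hq' c c₀ (ihY p hpY c) (hN2 q q' (st e)) (fun x => ihX q' hq' x)

end Count

end

end Summit.QuantumFields.BalabanUV.T4Continuum.PlacementSkeleton
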